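import Summits.QuantumFields.YangMills.Theorems.BalabanUVNodesN15KingModelSrcDivKnitAllEntries
import Summits.QuantumFields.YangMills.Theorems.BalabanUVNodesN15SizedKnitSocket
import HarnessLib

/-!
# N15 (NE2) — THE KING-MODEL RUNG, FILE 72 `…KingModelSrcDivKnitN15At`: `N15At` AND THE K3⁸ GUARD `Live` FOR THE KING JET WITH ALL FOUR (3.42) OPERATOR ENTRIES BACKGROUND-LIVE
# (the King-jet twin of dag-n15-a Λ-D `…TwoGridDressedLaplacianKnitN15At`, through dag-n15-a's sized knit socket S-D `…N15SizedKnitSocket`)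

WHO ∕ WHEN.  Cell `pub-ymgap`, seat `pub-ymgap-dag-n15-d` (R134, N15 NE2 s3 = King-model rung, g27); `--kind proof --supports stmt-QuantumFields-27366 --as helper` (K3⁸;
count-neutral).  0 `def`, theorems only; 0 `sorry`; standard axioms.  Over this seat's FILE 71 `…KingModelSrcDivKnitAllEntries` (★★★ `ne2PlusOperator_kingJet_allEntries`:
`T4EtaRate.NE2PlusOperator` BY NAME, hypothesis-free, for King's full `A = 0` propagator `⊗ 1` dressed by the first-order species on the (3.35)-pair carrier `coeffBgFO`, ALL FOUR
entries of the (3.42) jet background-live; `foKingFamilyAll`), dag-n15-a K-C `…KingModelDressedJetSupCarrier` (`foKingInstance` on dag-n15-e's rung index `EtaLatIdx d m₀²`: cube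
`2L^e`, coarse run `K ≥ 1`, shift `n ≥ 1`, mass `0 < m² ≤ m₀²`, size `M_sz ≥ 1`), dag-n15-a S-D `…N15SizedKnitSocket` (`geoS`, `siteOnS`, `covOnS`, ★★★ `n15At_opGeoS_of_ne2PlusOperator`,
★★ `live_opGeoS`, §5 keyed face), `NE2NodeTorus.ne2PlusOperator_reindex`, II-E `reg335_coeffBgFO_iff`, dag-n15-w2 `PairedFamilyGuard.Live`, part 30 `AtKeyedHome.s_N15_of_admits`,
the dagwriter's `YMDAG.UVSplit.N15At` ∕ `S_N15` BY NAME; nothing in the tree is modified.  PATTERN = Λ-D, decl for decl, on the King-jet index.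

THE ONE TECHNICAL POINT.  S-D's socket is written over the torus family of record: coarse carrier `opGeo (geoS d hL ι Mc i) (X i) (blk i)`, `geoS … i = unitTorusGeoS L (ι i).k
(TGIndex.Mn d hL (ι i)) (Mc i)`, periods `TGIndex.Mn d hL j = MP (paramsOf d L j.m_T j.k hL) = (2L^{m_T}, …, 2L^{m_T})`.  K-C's King-jet instance lives on the rung's cubes
`EtaLatIdx.cube L i = (2L^e, …, 2L^e)` — the SAME lattice: along the index map `i ↦ ⟨e, K, _, n⟩ : TGIndex`, size `M_sz`, the King-jet instance IS the socket literal, by `rfl`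
(§1 `foKingInstance_eq_opGeoS`).  The socket's UNIT layer ((2.156) `C^{(k)}_Λ`, part 76) wants L-divisible periods (`m_T ≥ 1`), so the knit is stated on the sub-index `e ≥ 1`
(cubes `2L^e`, `e ≥ 1`; FILE 71's operator layer holds for every `e` and is restricted along `Subtype.val` with the same constants — `ne2PlusOperator_reindex`); size `M_sz` and level
count `K` stay jointly cofinal there (§2 `kingJetIdx_cofinal`), so the guard is LIVE, not void.

WHAT.
* §1 `foKingInstance_eq_opGeoS` (`rfl`), `ne2PlusOperator_kingJet_allEntries_div` (FILE 71 ★★★ on `e ≥ 1`), ★★★ **`n15At_kingJet_allEntries`** — `N15At ⟨{i : EtaLatIdx d m₀² ∕∕ 1 ≤ i.e},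
  c₃₅, p, foKingInstance d L ·, foKingFamilyAll d L a ν κ ·, siteOnS a_S …, covOnS α β …, ⊤, dist⟩` OUTRIGHT (`d ≥ 1`, odd `L ≥ 2`, `a, a_S, c₃₅ > 0`, `m₀² ≥ 0`; every `p`,
  directions `ν κ α β`): OPERATOR = FILE 71 (King's `(A₀′⁻¹, A₀⁻¹) ⊗ 1` dressed by the first-order species — value, dressed gradient, dressed source divergence, dressed covariant
  Laplacian, ALL FOUR background-live under the (3.35) pair alone), SITE = dag-n15-c G1's genuine `(Q′G′²Q′*)⁻¹` kernel, UNIT = [B6] (2.156) `C^{(k)}_Λ` — both `U ≡ 1` kernels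
  re-based on `coeffBgFO` (their «+» idle, said); `layers_kingJet_allEntries` (the three conjuncts spelled out);
* §2 `reg_zero_foKingInstance` (the trivial pair field `0` is (3.35)∕(3.36)-regular at every `α₀ > 0`, `c₃₅ ≥ 0`), `kingJetIdx_cofinal`, ★★ `live_foKingInstance` (ANY kernels on the
  King-jet instances, `m₀² > 0`), ★★★ **`live_and_n15At_kingJet_allEntries`** (the pair the K3⁸ guard + rates holder read);
* §3 ★★ `s_N15_of_admits_kingJet_allEntries` (part 30's stage-generic keyed home: any reading pinned to the King-jet literal has `S_N15`).

HONEST FRAMING ∕ LIMITS.  By-name composition; no estimate proved here.  The OPERATOR layer carries the configuration genuinely in all four (3.42) entries — in KING's `A = 0` MODEL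
with the ABELIANISED scalar-multiplier species of (3.52)'s `V′(A)` and the block-averaged coarse partner (C3) (template literature [King1986] (2.13)–(2.17) p.653, (4.1)–(4.5)
p.670, Lemma 4.5 (4.38) p.674; [Balaban1985BackgroundPropagators] Thm 3.1 (3.42) p.397: SHAPES) — NOT Bałaban's covariant `G(U)` ((S3), dag-n15-c's lane); site ∕ unit layers are
the `U ≡ 1` kernels (U-blind); Bałaban's size `M` is live through the (3.35) letters `c₃₅·M·α₀` and the guard.  NE2⁺ as printed NOT PRINTED ∕ NOT proved; no statement of record
touched; N15 NOT discharged; K3⁸ OPEN, skeleton untouched; counts of record UNMOVED (typed 28∕28 · discharged 7∕28 after №245, = 7∕27 excl. NODE O); one finite torus per index at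
fixed `ε` — NOT ℝ⁴, NOT infinite volume, NOT OS, NOT a mass gap, NOT Clay.
-/

noncomputable section

namespace Summit.QuantumFields.YangMills.BalabanUVNodes.N15.KingModel.SrcDiv

open Literature.MathematicalPhysics.QuantumFieldTheory.Balaban1983to89
open Literature.MathematicalPhysics.QuantumFieldTheory.Balaban1983to89.T4Continuum (T4Family ULoop)
open Literature.MathematicalPhysics.QuantumFieldTheory.Balaban1983to89.T4EtaRate (EtaPairing PairedInstance NE2PlusOperator NE2PlusSite NE2PlusUnit)
open Literature.MathematicalPhysics.QuantumFieldTheory.Balaban1983to89.B5Prop11Plancherel (Tor fine)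
open Literature.MathematicalPhysics.QuantumFieldTheory.Balaban1983to89.NE2NodeTorus (ne2PlusOperator_reindex)
open Node00 (NE2Objects₁₁)
open Summit.QuantumFields.YangMills.BalabanUVNodes.N15.OperatorReadout (opGeo)
open Summit.QuantumFields.YangMills.BalabanUVNodes.N15.TwoGrid (TGIndex coeffBgFO reg335_coeffBgFO_iff)
open Summit.QuantumFields.YangMills.BalabanUVNodes.N15.TwoGrid.KingJet (foKingInstance)
open Summit.QuantumFields.YangMills.BalabanUVNodes.N15.BackgroundLayer (fgrad fgrad_apply)
open Summit.QuantumFields.YangMills.BalabanUVNodes.N15.VectorPiece (blkFine)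
open Summit.QuantumFields.YangMills.BalabanUVNodes.N15.GenuineRecord (geoS siteOnS covOnS n15At_opGeoS_of_ne2PlusOperator live_opGeoS)
open Summit.QuantumFields.YangMills.BalabanUVNodes.N15.AtKeyedHome (s_N15_of_admits)
open Summit.QuantumFields.YangMills.BalabanUVNodes.N15.PairedFamilyGuard (Live)
open Summit.QuantumFields.YangMills.BalabanUVNodes.N15KingModelRung.Curved (EtaLatIdx)
open YMDAG.UVSplit (Datum NE2Carriers RateCarriers RateRecordPred N15At S_N15 ne2OfRecord₁₁)

variable {d : ℕ} {L : ℕ} [NeZero L] {m0sq : ℝ}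

/-! ## §1 K-C's King-jet instance is an instance of the sized socket on the L-divisible cubes; `N15At` outright -/

/-- THE KING-JET INSTANCE IS THE SOCKET's LITERAL (`rfl`): along the index map `i ↦ ⟨e, K, _, n⟩ : TGIndex` with size `M_sz`, K-C's `foKingInstance d L i` on the cube `2L^e`
(`e ≥ 1`) is S-D's `⟨opGeo (geoS d hL ι Mc i) (X i) (blk i), gf, Bc, Bf, pair⟩` at the 1-form arguments `Tor (fine (L^K) (2L^e)) × Fin (d+1)` and King's blocks `blkFine` —
`MP (paramsOf d L e K hL) ≡ EtaLatIdx.cube L i` definitionally. [bookkeeping] -/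
theorem foKingInstance_eq_opGeoS (hL : Odd L ∧ 1 < L) :
    (fun i : {i : EtaLatIdx d m0sq // 1 ≤ i.e} => foKingInstance d L i.1) = fun i =>
      (⟨opGeo (geoS d hL (fun i : {i : EtaLatIdx d m0sq // 1 ≤ i.e} => (⟨i.1.e, i.1.K, i.1.one_le_K, i.1.n⟩ : TGIndex)) (fun i => i.1.Msz) i)
          (Tor (fine (L ^ i.1.K) (EtaLatIdx.cube L i.1)) × Fin (d + 1)) (blkFine L i.1.K (EtaLatIdx.cube L i.1)),
        (foKingInstance d L i.1).gf, (foKingInstance d L i.1).Bc, (foKingInstance d L i.1).Bf, (foKingInstance d L i.1).pair⟩ : PairedInstance) := rfl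

/-- FILE 71's ★★★ RESTRICTED TO THE L-DIVISIBLE CUBES `e ≥ 1` (same constants; `ne2PlusOperator_reindex` along `Subtype.val`). [bookkeeping] -/
theorem ne2PlusOperator_kingJet_allEntries_div (hd : 1 ≤ d) (hLodd : Odd L) (hL2 : 2 ≤ L) {a : ℝ} (ha : 0 < a) (hm0 : 0 ≤ m0sq) {c35 : ℝ} (hc35 : 0 < c35)
    (ν κ : Fin (d + 1)) :
    NE2PlusOperator c35 (fun i : {i : EtaLatIdx d m0sq // 1 ≤ i.e} => foKingInstance d L i.1) (fun i => foKingFamilyAll d L a ν κ i.1) :=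
  ne2PlusOperator_reindex (Subtype.val : {i : EtaLatIdx d m0sq // 1 ≤ i.e} → EtaLatIdx d m0sq) (ne2PlusOperator_kingJet_allEntries d hd hLodd hL2 ha hm0 c35 hc35 ν κ)

/-- ★★★ **`N15At` FOR THE KING JET WITH ALL FOUR OPERATOR ENTRIES BACKGROUND-LIVE, OUTRIGHT** (`d ≥ 1`, odd `L ≥ 2`, `a, a_S, c₃₅ > 0`, `m₀² ≥ 0`; every `p`, directions
`ν κ α β`; index = dag-n15-e's rung index on the L-divisible cubes `2L^e`, `e ≥ 1`): OPERATOR = FILE 71 `ne2PlusOperator_kingJet_allEntries` (King's `(A₀′⁻¹, A₀⁻¹) ⊗ 1` dressed by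
the first-order species on the (3.35)-pair carrier; value, dressed gradient, dressed source divergence, dressed covariant Laplacian live), SITE = G1's genuine `(Q′G′²Q′*)⁻¹` kernel,
UNIT = [B6] (2.156) `C^{(k)}_Λ`, through the sized socket S-D. [bookkeeping] -/
theorem n15At_kingJet_allEntries (hd : 1 ≤ d) (hLodd : Odd L) (hL2 : 2 ≤ L) (hL : Odd L ∧ 1 < L) {a aS c35 : ℝ} (ha : 0 < a) (haS : 0 < aS) (hc35 : 0 < c35)
    (hm0 : 0 ≤ m0sq) (ν κ α β : Fin (d + 1)) (p : ℝ) :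
    N15At { I := {i : EtaLatIdx d m0sq // 1 ≤ i.e}, c35 := c35, p := p, pi := fun i => foKingInstance d L i.1, Kop := fun i => foKingFamilyAll d L a ν κ i.1,
            Ksite := siteOnS d hL aS (fun i : {i : EtaLatIdx d m0sq // 1 ≤ i.e} => (⟨i.1.e, i.1.K, i.1.one_le_K, i.1.n⟩ : TGIndex)) (fun i => i.1.Msz)
              (fun i => Tor (fine (L ^ i.1.K) (EtaLatIdx.cube L i.1)) × Fin (d + 1)) (fun i => blkFine L i.1.K (EtaLatIdx.cube L i.1)) (fun i => (foKingInstance d L i.1).Bf),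
            Kunit := covOnS d hL α β (fun i : {i : EtaLatIdx d m0sq // 1 ≤ i.e} => (⟨i.1.e, i.1.K, i.1.one_le_K, i.1.n⟩ : TGIndex)) (fun i => i.1.Msz)
              (fun i => Tor (fine (L ^ i.1.K) (EtaLatIdx.cube L i.1)) × Fin (d + 1)) (fun i => blkFine L i.1.K (EtaLatIdx.cube L i.1)) (fun i => (foKingInstance d L i.1).Bf),
            inΛ := fun _ _ => True, unitDist := fun i => (foKingInstance d L i.1).gc.dist } :=
  n15At_opGeoS_of_ne2PlusOperator (d := d) hL (fun i : {i : EtaLatIdx d m0sq // 1 ≤ i.e} => (⟨i.1.e, i.1.K, i.1.one_le_K, i.1.n⟩ : TGIndex)) (fun i => i.1.Msz)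
    (fun i => Tor (fine (L ^ i.1.K) (EtaLatIdx.cube L i.1)) × Fin (d + 1)) (fun i => blkFine L i.1.K (EtaLatIdx.cube L i.1))
    (fun i => (foKingInstance d L i.1).gf) (fun i => (foKingInstance d L i.1).Bc) (fun i => (foKingInstance d L i.1).Bf)
    hd hLodd hL2 haS α β (fun i => i.2) (fun i => (foKingInstance d L i.1).pair) p (fun i => foKingFamilyAll d L a ν κ i.1)
    (ne2PlusOperator_kingJet_allEntries_div hd hLodd hL2 ha hm0 hc35 ν κ)

/-- **THE THREE LAYERS SPELLED OUT** for the King jet on the L-divisible cubes: `NE2PlusOperator` (FILE 71, all four entries live) ∧ `NE2PlusSite 4 p` (G1's genuine site kernel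
re-based) ∧ `NE2PlusUnit` ((2.156) re-based, region `⊤`, King's periodic distance). [bookkeeping] -/
theorem layers_kingJet_allEntries (hd : 1 ≤ d) (hLodd : Odd L) (hL2 : 2 ≤ L) (hL : Odd L ∧ 1 < L) {a aS c35 : ℝ} (ha : 0 < a) (haS : 0 < aS) (hc35 : 0 < c35)
    (hm0 : 0 ≤ m0sq) (ν κ α β : Fin (d + 1)) (p : ℝ) :
    NE2PlusOperator c35 (fun i : {i : EtaLatIdx d m0sq // 1 ≤ i.e} => foKingInstance d L i.1) (fun i => foKingFamilyAll d L a ν κ i.1) ∧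
    NE2PlusSite 4 p c35 (fun i : {i : EtaLatIdx d m0sq // 1 ≤ i.e} => foKingInstance d L i.1)
      (siteOnS d hL aS (fun i : {i : EtaLatIdx d m0sq // 1 ≤ i.e} => (⟨i.1.e, i.1.K, i.1.one_le_K, i.1.n⟩ : TGIndex)) (fun i => i.1.Msz)
        (fun i => Tor (fine (L ^ i.1.K) (EtaLatIdx.cube L i.1)) × Fin (d + 1)) (fun i => blkFine L i.1.K (EtaLatIdx.cube L i.1)) (fun i => (foKingInstance d L i.1).Bf)) ∧
    NE2PlusUnit c35 (fun i : {i : EtaLatIdx d m0sq // 1 ≤ i.e} => foKingInstance d L i.1)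
      (covOnS d hL α β (fun i : {i : EtaLatIdx d m0sq // 1 ≤ i.e} => (⟨i.1.e, i.1.K, i.1.one_le_K, i.1.n⟩ : TGIndex)) (fun i => i.1.Msz)
        (fun i => Tor (fine (L ^ i.1.K) (EtaLatIdx.cube L i.1)) × Fin (d + 1)) (fun i => blkFine L i.1.K (EtaLatIdx.cube L i.1)) (fun i => (foKingInstance d L i.1).Bf))
      (fun _ _ => True) (fun i => (foKingInstance d L i.1).gc.dist) :=
  n15At_kingJet_allEntries hd hLodd hL2 hL ha haS hc35 hm0 ν κ α β p

/-! ## §2 The King-jet instances pass the guard; guard ∧ estimate together -/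

/-- the trivial pair field `0` of K-C's fine (3.35)-pair carrier `coeffBgFO (2L^e) (L^nL^K) M_sz` is (3.35)∕(3.36)-regular at every `α₀ > 0` (`c₃₅ ≥ 0`; sups and first
quotients of `0` vanish). [folklore] -/
theorem reg_zero_foKingInstance {c35 : ℝ} (hc35 : 0 ≤ c35) (i : EtaLatIdx d m0sq) {α₀ : ℝ} (hα₀ : 0 < α₀) :
    (foKingInstance d L i).Bf.Reg335 c35 α₀ (foKingInstance d L i).Bf.one ∧ (foKingInstance d L i).Bf.Reg336 c35 α₀ (foKingInstance d L i).Bf.one := by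
  have hM : (0 : ℝ) ≤ i.Msz := zero_le_one.trans i.one_le_Msz
  have h0 : (0 : ℝ) ≤ c35 * i.Msz * α₀ := mul_nonneg (mul_nonneg hc35 hM) hα₀.le
  have h335 : (coeffBgFO (EtaLatIdx.cube L i) (L ^ i.n * L ^ i.K) i.Msz).Reg335 c35 α₀ (coeffBgFO (EtaLatIdx.cube L i) (L ^ i.n * L ^ i.K) i.Msz).one := by
    refine (reg335_coeffBgFO_iff (EtaLatIdx.cube L i) (L ^ i.n * L ^ i.K) i.Msz c35 α₀ _).2 ⟨fun z => ?_, fun μ' z => ?_, fun μ' κ' z => ?_⟩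
    · show |(0 : ℝ)| ≤ _; rw [abs_zero]; exact h0
    · show |(0 : ℝ)| ≤ _; rw [abs_zero]; exact h0
    · rw [fgrad_apply]
      show |((L ^ i.n * L ^ i.K : ℕ) : ℝ) * ((0 : ℝ) - 0)| ≤ _
      rw [sub_zero, mul_zero, abs_zero]; exact h0
  exact ⟨h335, h335⟩

/-- SIZE AND LEVEL COUNT ARE JOINTLY COFINAL ON THE L-DIVISIBLE CUBES (`m₀² > 0`: the mass window is inhabited; witness `e = 1`, `n = 1`, `m² = m₀²`). NOT the empty-guard trap.
[folklore] -/
theorem kingJetIdx_cofinal (hm0 : 0 < m0sq) (M₅ : ℝ) (k₀ : ℕ) :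
    ∃ i : {i : EtaLatIdx d m0sq // 1 ≤ i.e}, M₅ ≤ i.1.Msz ∧ k₀ ≤ i.1.K :=
  ⟨⟨⟨1, max k₀ 1, le_max_right _ _, 1, le_rfl, m0sq, hm0, le_rfl, max M₅ 1, le_max_right _ _⟩, le_rfl⟩, le_max_left _ _, le_max_left _ _⟩

/-- ★★ **THE KING-JET INSTANCE FAMILY PASSES THE K3⁷∕K3⁸ GUARD** (dag-n15-w2's `Live` BY NAME) for ANY kernels (`m₀² > 0`, `c₃₅ ≥ 0`): size `M_sz` and scale count `K` jointly
cofinal (`kingJetIdx_cofinal`), the trivial field regular, the region `⊤` met. [bookkeeping] -/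
theorem live_foKingInstance (hL : Odd L ∧ 1 < L) (hm0 : 0 < m0sq) {c35 : ℝ} (hc35 : 0 ≤ c35) (p : ℝ)
    (Kop : ∀ i : {i : EtaLatIdx d m0sq // 1 ≤ i.e}, B9.KernelFamily (foKingInstance d L i.1).gc (foKingInstance d L i.1).Bf)
    (Ksite Kunit : ∀ i : {i : EtaLatIdx d m0sq // 1 ≤ i.e}, B9.SiteKernel (foKingInstance d L i.1).gc (foKingInstance d L i.1).Bf) :
    Live ⟨{i : EtaLatIdx d m0sq // 1 ≤ i.e}, c35, p, fun i => foKingInstance d L i.1, Kop, Ksite, Kunit, fun _ _ => True, fun i => (foKingInstance d L i.1).gc.dist⟩ :=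
  live_opGeoS (d := d) hL (fun i : {i : EtaLatIdx d m0sq // 1 ≤ i.e} => (⟨i.1.e, i.1.K, i.1.one_le_K, i.1.n⟩ : TGIndex)) (fun i => i.1.Msz)
    (fun i => Tor (fine (L ^ i.1.K) (EtaLatIdx.cube L i.1)) × Fin (d + 1)) (fun i => blkFine L i.1.K (EtaLatIdx.cube L i.1))
    (fun i => (foKingInstance d L i.1).gf) (fun i => (foKingInstance d L i.1).Bc) (fun i => (foKingInstance d L i.1).Bf)
    (fun i => (foKingInstance d L i.1).pair) c35 p Kop Ksite Kunit (kingJetIdx_cofinal hm0) (fun i _ hα₀ => reg_zero_foKingInstance hc35 i.1 hα₀)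

/-- ★★★ **GUARD ∧ `N15At` FOR THE KING JET WITH ALL FOUR OPERATOR ENTRIES BACKGROUND-LIVE** (`d ≥ 1`, odd `L ≥ 2`, `a, a_S, c₃₅ > 0`, `m₀² > 0`). [bookkeeping] -/
theorem live_and_n15At_kingJet_allEntries (hd : 1 ≤ d) (hLodd : Odd L) (hL2 : 2 ≤ L) (hL : Odd L ∧ 1 < L) {a aS c35 : ℝ} (ha : 0 < a) (haS : 0 < aS)
    (hc35 : 0 < c35) (hm0 : 0 < m0sq) (ν κ α β : Fin (d + 1)) (p : ℝ) :
    Live ⟨{i : EtaLatIdx d m0sq // 1 ≤ i.e}, c35, p, fun i => foKingInstance d L i.1, fun i => foKingFamilyAll d L a ν κ i.1,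
        siteOnS d hL aS (fun i : {i : EtaLatIdx d m0sq // 1 ≤ i.e} => (⟨i.1.e, i.1.K, i.1.one_le_K, i.1.n⟩ : TGIndex)) (fun i => i.1.Msz)
          (fun i => Tor (fine (L ^ i.1.K) (EtaLatIdx.cube L i.1)) × Fin (d + 1)) (fun i => blkFine L i.1.K (EtaLatIdx.cube L i.1)) (fun i => (foKingInstance d L i.1).Bf),
        covOnS d hL α β (fun i : {i : EtaLatIdx d m0sq // 1 ≤ i.e} => (⟨i.1.e, i.1.K, i.1.one_le_K, i.1.n⟩ : TGIndex)) (fun i => i.1.Msz)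
          (fun i => Tor (fine (L ^ i.1.K) (EtaLatIdx.cube L i.1)) × Fin (d + 1)) (fun i => blkFine L i.1.K (EtaLatIdx.cube L i.1)) (fun i => (foKingInstance d L i.1).Bf),
        fun _ _ => True, fun i => (foKingInstance d L i.1).gc.dist⟩ ∧
      N15At { I := {i : EtaLatIdx d m0sq // 1 ≤ i.e}, c35 := c35, p := p, pi := fun i => foKingInstance d L i.1, Kop := fun i => foKingFamilyAll d L a ν κ i.1,
              Ksite := siteOnS d hL aS (fun i : {i : EtaLatIdx d m0sq // 1 ≤ i.e} => (⟨i.1.e, i.1.K, i.1.one_le_K, i.1.n⟩ : TGIndex)) (fun i => i.1.Msz)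
                (fun i => Tor (fine (L ^ i.1.K) (EtaLatIdx.cube L i.1)) × Fin (d + 1)) (fun i => blkFine L i.1.K (EtaLatIdx.cube L i.1)) (fun i => (foKingInstance d L i.1).Bf),
              Kunit := covOnS d hL α β (fun i : {i : EtaLatIdx d m0sq // 1 ≤ i.e} => (⟨i.1.e, i.1.K, i.1.one_le_K, i.1.n⟩ : TGIndex)) (fun i => i.1.Msz)
                (fun i => Tor (fine (L ^ i.1.K) (EtaLatIdx.cube L i.1)) × Fin (d + 1)) (fun i => blkFine L i.1.K (EtaLatIdx.cube L i.1)) (fun i => (foKingInstance d L i.1).Bf),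
              inΛ := fun _ _ => True, unitDist := fun i => (foKingInstance d L i.1).gc.dist } :=
  ⟨live_foKingInstance hL hm0 hc35.le p _ _ _, n15At_kingJet_allEntries hd hLodd hL2 hL ha haS hc35 hm0.le ν κ α β p⟩

/-! ## §3 The keyed-home face (part 30's interface) -/

variable {N : ℕ} [NeZero N] {key : (F : T4Family) → Datum F N → Prop}

/-- ★★ **THE ALL-ENTRIES-LIVE KING-JET FAMILY AT ANY KEYED HOME** (part 30's interface): a rate home over ANY key admitting only the literals of a key-indexed NE2 reading whose
value everywhere is the King-jet literal has `S_N15 RRec` (`d ≥ 1`, odd `L ≥ 2`, `a, a_S, c₃₅ > 0`, `m₀² ≥ 0`). [bookkeeping] -/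
theorem s_N15_of_admits_kingJet_allEntries (hd : 1 ≤ d) (hLodd : Odd L) (hL2 : 2 ≤ L) (hL : Odd L ∧ 1 < L) {a aS c35 : ℝ} (ha : 0 < a) (haS : 0 < aS)
    (hc35 : 0 < c35) (hm0 : 0 ≤ m0sq) (ν κ α β : Fin (d + 1)) (p : ℝ)
    (ne2At : ∀ {F : T4Family} {D : Datum F N}, key F D → (ℕ → ℝ) → List (ULoop F) → ℕ → NE2Objects₁₁) (RRec : RateRecordPred N)
    (hadm : ∀ (F : T4Family) (D : Datum F N) (g₀ : ℕ → ℝ) (os : List (ULoop F)) (R : RateCarriers N), RRec F D g₀ os R →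
      ∃ (h : key F D) (k : ℕ), R.ne2 = ne2OfRecord₁₁ (ne2At h g₀ os k))
    (h : ∀ (F : T4Family) (D : Datum F N) (h : key F D) (g₀ : ℕ → ℝ) (os : List (ULoop F)) (k : ℕ),
      ne2At h g₀ os k = ⟨{i : EtaLatIdx d m0sq // 1 ≤ i.e}, c35, p, fun i => foKingInstance d L i.1, fun i => foKingFamilyAll d L a ν κ i.1,
        siteOnS d hL aS (fun i : {i : EtaLatIdx d m0sq // 1 ≤ i.e} => (⟨i.1.e, i.1.K, i.1.one_le_K, i.1.n⟩ : TGIndex)) (fun i => i.1.Msz)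
          (fun i => Tor (fine (L ^ i.1.K) (EtaLatIdx.cube L i.1)) × Fin (d + 1)) (fun i => blkFine L i.1.K (EtaLatIdx.cube L i.1)) (fun i => (foKingInstance d L i.1).Bf),
        covOnS d hL α β (fun i : {i : EtaLatIdx d m0sq // 1 ≤ i.e} => (⟨i.1.e, i.1.K, i.1.one_le_K, i.1.n⟩ : TGIndex)) (fun i => i.1.Msz)
          (fun i => Tor (fine (L ^ i.1.K) (EtaLatIdx.cube L i.1)) × Fin (d + 1)) (fun i => blkFine L i.1.K (EtaLatIdx.cube L i.1)) (fun i => (foKingInstance d L i.1).Bf),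
        fun _ _ => True, fun i => (foKingInstance d L i.1).gc.dist⟩) :
    S_N15 RRec :=
  s_N15_of_admits ne2At RRec hadm fun F D hk g₀ os k => by
    rw [h F D hk g₀ os k]; exact n15At_kingJet_allEntries hd hLodd hL2 hL ha haS hc35 hm0 ν κ α β p

end Summit.QuantumFields.YangMills.BalabanUVNodes.N15.KingModel.SrcDiv

end
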